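import Mathlib
import Literature.Analysis.PDE.SingleEntropy.WeightedAverages
import HarnessLib

/-!
# The potential is a viscosity supersolution of `hₜ + f(hₓ) = 0` (DLOW Thm 2.3, §4.2)

Topic `Literature/Analysis/PDE/SingleEntropy` — part of the formalization of
De Lellis–Otto–Westdickenberg, *Minimal entropy conditions for Burgers equation*, Quart. Appl.
Math. 62 (2004) 687–700, Thm 2.3 / Cor 2.5 (the named fact
`Literature.Analysis.PDE.deLellisOttoWestdickenberg_singleEntropy`).

`viscosity_supersolution`: if `u ∈ L^∞` satisfies the SINGLE entropy inequality
`η(u)ₜ + q(u)ₓ ≤ 0` in `𝒟'(Ω)` for a uniformly convex pair `f, η` (`f'' ≥ a > 0`, `η'' ≥ b > 0`,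
`q' = f'η'`) and `h` is bounded Lipschitz with a.e. gradient `(-f(u), u)` on an open `V ⊆ Ω`, then
at every local minimum `z₀ ∈ V` of `h - ζ` (`ζ` of class `C¹` near `z₀`):
`ζₜ(z₀) + f(ζₓ(z₀)) ≥ 0`. This is the heart of Theorem 2.3 of the paper (§4.2). The proof here is
a WEIGHTED variant of the printed one: instead of averaging over the connected component `Ω_δ` of
a sublevel set of `h - ζ`, we test the entropy inequality with `ψ = χ_δ(h - ζ + |· - z₀|² - c₀)`
for a smooth nonincreasing cutoff `χ_δ` and average against the weight `w = -χ_δ'(…) ≥ 0`;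
the identities `∫ ∇ψ = 0` ((4.3)–(4.4) of the paper), the tested entropy inequality ((4.6)) and
Prop. 3.2 for the probability `w dz / ∫ w` ((4.8)) give concentration of the `w`-law of `u`
((4.9)) and hence the supersolution inequality (`supersolution_core`; the `κ`-limit is taken in
`viscosity_supersolution`). [cite: DelellisOttoWestdickenberg2004, Thm 2.3, §4.2]
-/

noncomputable section

open MeasureTheory Set Filter Metric ContinuousLinearMap
open scoped Topology Convolution NNReal

namespace Literature.Analysis.PDE.SingleEntropy

/-! ## The potential is a viscosity supersolution (DLOW §4.2, weighted variant) -/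

section Supersolution

open scoped NNReal

/-- Continuity by gluing: continuous on a ball and zero outside a smaller concentric ball. [folklore] -/
theorem continuous_of_ball {F : ℝ × ℝ → ℝ} {z₀ : ℝ × ℝ} {ρ₁ ρ₂ : ℝ} (h12 : ρ₁ < ρ₂)
    (h1 : ∀ z ∈ ball z₀ ρ₂, ContinuousAt F z) (h2 : ∀ z ∉ ball z₀ ρ₁, F z = 0) :
    Continuous F := by
  rw [continuous_iff_continuousAt]
  intro z
  by_cases hz : z ∈ ball z₀ ρ₂
  · exact h1 z hz
  · have hopen : IsOpen (closedBall z₀ ρ₁)ᶜ := isClosed_closedBall.isOpen_compl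
    have hzm : z ∈ (closedBall z₀ ρ₁)ᶜ := fun h => hz (closedBall_subset_ball h12 h)
    have : F =ᶠ[𝓝 z] fun _ => 0 :=
      Filter.eventually_of_mem (hopen.mem_nhds hzm) fun y hy =>
        h2 y (fun h => hy (ball_subset_closedBall h))
    exact continuousAt_const.congr this.symm

set_option maxHeartbeats 1600000 in
-- a single long proof (the analytic heart of the paper); the default heartbeat budget is too small
/-- **Core estimate for the supersolution property** (De Lellis–Otto–Westdickenberg 2004, §4.2,
in a weighted form). Fix a local minimum `z₀` of `h - ζ` (valid on `ball z₀ (2r) ⊆ V`, `ζ` of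
class `C¹` there), the strict-minimum perturbation `q₀(z) = |z - z₀|²` and `δ ≤ r²/4`. With the
cutoff `χ` of `exists_cutoff`, the Lipschitz test function `ψ = χ(h - ζ + q₀ - c₀)` and the
weight `w = -χ'(·) ≥ 0`, the single entropy inequality, the identities `∫ ∇ψ = 0` and Prop. 3.2
(weighted) force the `w`-average of `u` to concentrate, which yields
`ζₜ(z₀) + f(ζₓ(z₀)) ≥ -(ω + L_f ω + L_f λ + 48 L_f (C_η + C_q) ω / (a b λ³))` for every `λ > 0`,
where `ω` bounds the oscillation of `∇(ζ - q₀)` on `{q₀ < δ}`.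
[cite: DelellisOttoWestdickenberg2004, Thm 2.3 (proof, §4.2)] -/
theorem supersolution_core {f η q : ℝ → ℝ} {a b : ℝ} (hf : ContDiff ℝ 2 f) (hη : ContDiff ℝ 2 η)
    (ha : 0 < a) (hb : 0 < b) (hfa : ∀ w, a ≤ deriv (deriv f) w)
    (hηb : ∀ w, b ≤ deriv (deriv η) w) (hq : ∀ w, HasDerivAt q (deriv f w * deriv η w) w)
    {Ω : Set (ℝ × ℝ)} (hΩ : IsOpen Ω) {u : ℝ × ℝ → ℝ} (hu : Measurable u) {M : ℝ}
    (huM : ∀ p, |u p| ≤ M)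
    (hE : ∀ φ : ℝ × ℝ → ℝ, ContDiff ℝ (⊤ : ℕ∞) φ → HasCompactSupport φ → tsupport φ ⊆ Ω →
      (∀ p, 0 ≤ φ p) →
      0 ≤ ∫ p in Ω, (η (u p) * deriv (fun t => φ (t, p.2)) p.1
        + q (u p) * deriv (fun x => φ (p.1, x)) p.2))
    {h : ℝ × ℝ → ℝ} {L : ℝ≥0} (hh : LipschitzWith L h)
    {V : Set (ℝ × ℝ)} (hVΩ : V ⊆ Ω)
    (hae : ∀ᵐ z ∂(volume : Measure (ℝ × ℝ)), z ∈ V →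
      DifferentiableAt ℝ h z ∧ fderiv ℝ h z (1, 0) = -f (u z) ∧ fderiv ℝ h z (0, 1) = u z)
    {z₀ : ℝ × ℝ} {ζ : ℝ × ℝ → ℝ} {r : ℝ} (hr : 0 < r) (hrV : ball z₀ (2 * r) ⊆ V)
    (hζ : ∀ y ∈ ball z₀ (2 * r), ContDiffAt ℝ 1 ζ y)
    (hmin : ∀ y ∈ ball z₀ (2 * r), h z₀ - ζ z₀ ≤ h y - ζ y)
    {Cη Cq Lf : ℝ} (hCη0 : 0 ≤ Cη) (hCq0 : 0 ≤ Cq) (hLf0 : 0 ≤ Lf)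
    (hCη : ∀ w, |w| ≤ M → |η w| ≤ Cη) (hCq : ∀ w, |w| ≤ M → |q w| ≤ Cq)
    (hLf : ∀ x y, |x| ≤ M + 1 → |y| ≤ M + 1 → |f x - f y| ≤ Lf * |x - y|)
    {δ ω : ℝ} (hδ : 0 < δ) (hδr : δ ≤ r ^ 2 / 4) (hω0 : 0 < ω) (hω1 : ω ≤ 1)
    (hω : ∀ y ∈ ball z₀ r, (y.1 - z₀.1) ^ 2 + (y.2 - z₀.2) ^ 2 < δ →
      |fderiv ℝ ζ y (1, 0) - fderiv ℝ (fun z : ℝ × ℝ => (z.1 - z₀.1) ^ 2 + (z.2 - z₀.2) ^ 2) y (1, 0)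
          - fderiv ℝ ζ z₀ (1, 0)| ≤ ω ∧
      |fderiv ℝ ζ y (0, 1) - fderiv ℝ (fun z : ℝ × ℝ => (z.1 - z₀.1) ^ 2 + (z.2 - z₀.2) ^ 2) y (0, 1)
          - fderiv ℝ ζ z₀ (0, 1)| ≤ ω)
    {lam : ℝ} (hlam : 0 < lam) :
    -(ω + Lf * ω + Lf * lam + 48 * Lf * (Cη + Cq) * ω / (a * b * lam ^ 3))
      ≤ fderiv ℝ ζ z₀ (1, 0) + f (fderiv ℝ ζ z₀ (0, 1)) := by
  ----------------------------------------------------------------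
  -- Step 0: the perturbation, the gauge `g`, basic regularity
  ----------------------------------------------------------------
  set T₀ : ℝ := fderiv ℝ ζ z₀ (1, 0) with hT₀
  set X₀ : ℝ := fderiv ℝ ζ z₀ (0, 1) with hX₀
  set qd : ℝ × ℝ → ℝ := fun z => (z.1 - z₀.1) ^ 2 + (z.2 - z₀.2) ^ 2 with hqd
  have hqds : ContDiff ℝ (⊤ : ℕ∞) qd := by simp only [hqd]; fun_prop
  have hqd1 : Differentiable ℝ qd := hqds.differentiable (by simp)
  have hqd0 : qd z₀ = 0 := by simp [hqd]
  have hqdlow : ∀ z, (dist z z₀) ^ 2 ≤ qd z := by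
    intro z
    rw [Prod.dist_eq, Real.dist_eq, Real.dist_eq]
    simp only [hqd]
    rcases le_total |z.1 - z₀.1| |z.2 - z₀.2| with hle | hle
    · rw [max_eq_right hle]; nlinarith [sq_abs (z.2 - z₀.2), sq_nonneg (z.1 - z₀.1)]
    · rw [max_eq_left hle]; nlinarith [sq_abs (z.1 - z₀.1), sq_nonneg (z.2 - z₀.2)]
  have hqdnn : ∀ z, 0 ≤ qd z := fun z => le_trans (sq_nonneg _) (hqdlow z)
  set c₀ : ℝ := h z₀ - ζ z₀ with hc₀
  set g : ℝ × ℝ → ℝ := fun z => max (h z - ζ z - c₀) 0 + qd z with hg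
  have hg_ball : ∀ z ∈ ball z₀ (2 * r), g z = h z - ζ z - c₀ + qd z := by
    intro z hz
    simp only [hg]
    rw [max_eq_left (by linarith [hmin z hz])]
  have hg_low : ∀ z, qd z ≤ g z := fun z => by
    simp only [hg]; linarith [le_max_right (h z - ζ z - c₀) 0]
  have hg0 : g z₀ = 0 := by
    rw [hg_ball z₀ (mem_ball_self (by linarith)), hqd0]; simp [hc₀]
  have hgnn : ∀ z, 0 ≤ g z := fun z => (hqdnn z).trans (hg_low z)
  -- where `g` is small the point is close to `z₀`
  have hsmall : ∀ z, g z < r ^ 2 / 4 → z ∈ ball z₀ (r / 2) := by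
    intro z hz
    rw [mem_ball]
    have h1 : (dist z z₀) ^ 2 < (r / 2) ^ 2 := by nlinarith [hqdlow z, hg_low z]
    by_contra hge
    push Not at hge
    nlinarith [hge, dist_nonneg (x := z) (y := z₀)]
  -- differentiability of `ζ` on the big ball, continuity of its derivative
  have hζd : ∀ y ∈ ball z₀ (2 * r), DifferentiableAt ℝ ζ y := fun y hy =>
    (hζ y hy).differentiableAt (by simp)
  have hζc : ∀ y ∈ ball z₀ (2 * r), ContinuousAt ζ y := fun y hy => (hζd y hy).continuousAt
  have hζfc : ∀ y ∈ ball z₀ (2 * r), ContinuousAt (fderiv ℝ ζ) y := fun y hy =>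
    (hζ y hy).continuousAt_fderiv (by simp)
  have hrr : ball z₀ r ⊆ ball z₀ (2 * r) := ball_subset_ball (by linarith)
  have hcr : closedBall z₀ r ⊆ ball z₀ (2 * r) := closedBall_subset_ball (by linarith)
  ----------------------------------------------------------------
  -- Step 1: the cutoff, the test function `ψ` and the weight `w`
  ----------------------------------------------------------------
  obtain ⟨χ, hχs, hχ1, hχ2, hχ0, hχ', ⟨Cχ, hCχ0, hχ'low⟩, hχ'1, hχ'2⟩ := exists_cutoff hδ
  have hχd : Differentiable ℝ χ := hχs.differentiable (by simp)
  have hχ'c : Continuous (deriv χ) := hχs.continuous_deriv (by simp)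
  have h34 : 3 * δ / 4 < r ^ 2 / 4 := by nlinarith
  set ψ : ℝ × ℝ → ℝ := fun z => χ (g z) with hψ
  set w : ℝ × ℝ → ℝ := (ball z₀ r).indicator (fun z => -(deriv χ (g z))) with hw
  -- support properties
  have hψ0 : ∀ z ∉ ball z₀ (r / 2), ψ z = 0 := by
    intro z hz
    simp only [hψ]
    apply hχ2
    by_contra hlt
    push Not at hlt
    exact hz (hsmall z (by linarith))
  have hw_ball : ∀ z ∈ ball z₀ r, w z = -(deriv χ (g z)) := fun z hz => by
    simp only [hw]; rw [indicator_of_mem hz]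
  have hw_out : ∀ z ∉ ball z₀ r, w z = 0 := fun z hz => by
    simp only [hw]; rw [indicator_of_notMem hz]
  have hw0' : ∀ z ∉ ball z₀ (r / 2), w z = 0 := by
    intro z hz
    by_cases hzr : z ∈ ball z₀ r
    · rw [hw_ball z hzr, hχ'2 _ (by
        by_contra hlt
        push Not at hlt
        exact hz (hsmall z (by linarith))), neg_zero]
    · exact hw_out z hzr
  have hwnn : ∀ z, 0 ≤ w z := fun z => by
    by_cases hzr : z ∈ ball z₀ r
    · rw [hw_ball z hzr]; linarith [hχ' (g z)]
    · rw [hw_out z hzr]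
  have hwC : ∀ z, |w z| ≤ Cχ := fun z => by
    rw [abs_of_nonneg (hwnn z)]
    by_cases hzr : z ∈ ball z₀ r
    · rw [hw_ball z hzr]; linarith [hχ'low (g z)]
    · rw [hw_out z hzr]; exact hCχ0
  -- where `w ≠ 0`, `g < δ` hence `qd < δ` and the oscillation bound applies
  have hwsupp : ∀ z, w z ≠ 0 → z ∈ ball z₀ r ∧ qd z < δ := by
    intro z hz
    have hzr : z ∈ ball z₀ r := by
      by_contra h'
      exact hz (hw_out z h')
    refine ⟨hzr, ?_⟩
    have : g z ≤ 3 * δ / 4 := by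
      by_contra hlt
      push Not at hlt
      exact hz (by rw [hw_ball z hzr, hχ'2 _ hlt, neg_zero])
    linarith [hg_low z]
  ----------------------------------------------------------------
  -- Step 2: Lipschitz and support properties of `ψ`, continuity of `w`
  ----------------------------------------------------------------
  obtain ⟨Cζ, hCζ⟩ := (isCompact_closedBall z₀ r).exists_bound_of_continuousOn
    (f := fderiv ℝ ζ) (continuousOn_of_forall_continuousAt fun y hy => hζfc y (hcr hy))
  obtain ⟨Cqd, hCqd⟩ := (isCompact_closedBall z₀ r).exists_bound_of_continuousOn
    (f := fderiv ℝ qd) ((hqds.continuous_fderiv (by simp)).continuousOn)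
  have hζL : LipschitzOnWith (Real.toNNReal Cζ) ζ (ball z₀ r) :=
    Convex.lipschitzOnWith_of_nnnorm_fderiv_le (fun x hx => hζd x (hrr hx))
      (fun x hx => by
        rw [← NNReal.coe_le_coe, coe_nnnorm]
        exact (hCζ x (ball_subset_closedBall hx)).trans (Real.le_coe_toNNReal Cζ))
      (convex_ball z₀ r)
  have hqdL : LipschitzOnWith (Real.toNNReal Cqd) qd (ball z₀ r) :=
    Convex.lipschitzOnWith_of_nnnorm_fderiv_le (fun x _ => hqd1 x)
      (fun x hx => by
        rw [← NNReal.coe_le_coe, coe_nnnorm]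
        exact (hCqd x (ball_subset_closedBall hx)).trans (Real.le_coe_toNNReal Cqd))
      (convex_ball z₀ r)
  have hinnerL : LipschitzOnWith (L + Real.toNNReal Cζ + 0) (fun z => h z - ζ z - c₀) (ball z₀ r) :=
    (hh.lipschitzOnWith.sub hζL).sub (LipschitzWith.const c₀).lipschitzOnWith
  have hmaxL : LipschitzWith 1 (fun x : ℝ => max x 0) := LipschitzWith.id.max_const 0
  have hgL : LipschitzOnWith (1 * (L + Real.toNNReal Cζ + 0) + Real.toNNReal Cqd) g (ball z₀ r) := by
    have := (hmaxL.comp_lipschitzOnWith hinnerL).add hqdL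
    exact this
  clear hinnerL
  obtain ⟨Kg, hgL⟩ : ∃ K : ℝ≥0, LipschitzOnWith K g (ball z₀ r) := ⟨_, hgL⟩
  have hχL : LipschitzWith (Real.toNNReal Cχ) χ :=
    lipschitzWith_of_nnnorm_deriv_le hχd (fun x => by
      rw [← NNReal.coe_le_coe, coe_nnnorm, Real.norm_eq_abs]
      refine le_trans ?_ (Real.le_coe_toNNReal Cχ)
      rw [abs_le]; exact ⟨hχ'low x, (hχ' x).trans hCχ0⟩)
  have hψL_ball : LipschitzOnWith (Real.toNNReal Cχ * Kg) ψ (ball z₀ r) := by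
    have := hχL.comp_lipschitzOnWith hgL
    exact this
  have hψLip : LipschitzWith (Real.toNNReal Cχ * Kg) ψ :=
    lipschitzWith_of_ball (ρ₁ := r / 2) (ρ₂ := r) (by linarith) hψL_ball hψ0
  have hψsupp : Function.support ψ ⊆ ball z₀ (r / 2) := fun z hz => by
    by_contra h'; exact hz (hψ0 z h')
  have hψcs : HasCompactSupport ψ :=
    HasCompactSupport.of_support_subset_isCompact (isCompact_closedBall z₀ (r / 2))
      (hψsupp.trans ball_subset_closedBall)
  have hψts : tsupport ψ ⊆ closedBall z₀ (r / 2) :=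
    closure_minimal (hψsupp.trans ball_subset_closedBall) isClosed_closedBall
  have hψΩ : tsupport ψ ⊆ Ω :=
    ((hψts.trans (closedBall_subset_ball (by linarith))).trans hrV).trans hVΩ
  have hψnn : ∀ z, 0 ≤ ψ z := fun z => hχ0 _
  -- continuity of `g`, `w`
  have hgc : ∀ z ∈ ball z₀ r, ContinuousAt g z := fun z hz => by
    simp only [hg]
    exact (((hh.continuous.continuousAt.sub (hζc z (hrr hz))).sub continuousAt_const).max
      continuousAt_const).add hqds.continuous.continuousAt
  have hwc : Continuous w := by
    refine continuous_of_ball (ρ₁ := r / 2) (ρ₂ := r) (by linarith) (fun z hz => ?_) hw0'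
    have hev : w =ᶠ[𝓝 z] fun y => -(deriv χ (g y)) :=
      Filter.eventually_of_mem (isOpen_ball.mem_nhds hz) fun y hy => hw_ball y hy
    exact ((hχ'c.continuousAt.comp (hgc z hz)).neg).congr hev.symm
  have hwm : Measurable w := hwc.measurable
  have hwK : ∀ z ∉ closedBall z₀ (r / 2), w z = 0 := fun z hz =>
    hw0' z (fun h' => hz (ball_subset_closedBall h'))
  have hKc : IsCompact (closedBall z₀ (r / 2)) := isCompact_closedBall _ _
  ----------------------------------------------------------------
  -- Step 3: the a.e. line derivatives of `ψ`
  ----------------------------------------------------------------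
  set Zt : ℝ × ℝ → ℝ := fun z => fderiv ℝ ζ z (1, 0) - fderiv ℝ qd z (1, 0) with hZt
  set Zx : ℝ × ℝ → ℝ := fun z => fderiv ℝ ζ z (0, 1) - fderiv ℝ qd z (0, 1) with hZx
  have hD : ∀ᵐ z ∂(volume : Measure (ℝ × ℝ)),
      lineDeriv ℝ ψ z (1, 0) = -(w z) * (-f (u z) - Zt z) ∧
      lineDeriv ℝ ψ z (0, 1) = -(w z) * (u z - Zx z) := by
    filter_upwards [hae] with z hz
    by_cases hzr : z ∈ ball z₀ r
    · obtain ⟨hdh, h1, h2⟩ := hz (hrV (hrr hzr))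
      have hev : ψ =ᶠ[𝓝 z] fun y => χ (h y - ζ y - c₀ + qd y) :=
        Filter.eventually_of_mem (isOpen_ball.mem_nhds (hrr hzr)) fun y hy => by
          simp only [hψ]; rw [hg_ball y hy]
      have hinner : HasFDerivAt (fun y => h y - ζ y - c₀ + qd y)
          (fderiv ℝ h z - fderiv ℝ ζ z + fderiv ℝ qd z) z :=
        ((hdh.hasFDerivAt.sub (hζd z (hrr hzr)).hasFDerivAt).sub_const c₀).add
          (hqd1 z).hasFDerivAt
      have hcomp : HasFDerivAt (fun y => χ (h y - ζ y - c₀ + qd y))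
          (deriv χ (g z) • (fderiv ℝ h z - fderiv ℝ ζ z + fderiv ℝ qd z)) z := by
        have := (hχd (h z - ζ z - c₀ + qd z)).hasDerivAt.comp_hasFDerivAt z hinner
        rwa [← hg_ball z (hrr hzr)] at this
      have hψd : HasFDerivAt ψ (deriv χ (g z) • (fderiv ℝ h z - fderiv ℝ ζ z + fderiv ℝ qd z)) z :=
        hcomp.congr_of_eventuallyEq hev
      rw [hψd.differentiableAt.lineDeriv_eq_fderiv, hψd.differentiableAt.lineDeriv_eq_fderiv,
        hψd.fderiv, hw_ball z hzr]
      simp only [_root_.smul_apply, _root_.add_apply, _root_.sub_apply, smul_eq_mul,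
        h1, h2, hZt, hZx]
      constructor <;> ring
    · have hzc : z ∈ (closedBall z₀ (r / 2))ᶜ := fun h' =>
        hzr (closedBall_subset_ball (by linarith) h')
      have hev : ψ =ᶠ[𝓝 z] fun _ => (0 : ℝ) :=
        Filter.eventually_of_mem (isClosed_closedBall.isOpen_compl.mem_nhds hzc) fun y hy =>
          hψ0 y (fun h' => hy (ball_subset_closedBall h'))
      have hψd : HasFDerivAt ψ (0 : ℝ × ℝ →L[ℝ] ℝ) z :=
        (hasFDerivAt_const (0 : ℝ) z).congr_of_eventuallyEq hev
      rw [hψd.differentiableAt.lineDeriv_eq_fderiv, hψd.differentiableAt.lineDeriv_eq_fderiv,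
        hψd.fderiv, hw_out z hzr]
      simp
  ----------------------------------------------------------------
  -- Step 4: integrability and the weighted identities
  ----------------------------------------------------------------
  have hqc : Continuous q := continuous_iff_continuousAt.2 fun w => (hq w).continuousAt
  have hM0 : 0 ≤ M := (abs_nonneg _).trans (huM z₀)
  -- the weights `w`, `w Zt`, `w Zx`
  have hZtb : ∀ z, w z ≠ 0 → |Zt z - T₀| ≤ ω ∧ |Zx z - X₀| ≤ ω := fun z hz => by
    obtain ⟨hzr, hq'⟩ := hwsupp z hz
    have := hω z hzr hq'
    simpa only [hZt, hZx, hT₀, hX₀] using this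
  have hwZt_pt : ∀ z, |w z * (Zt z - T₀)| ≤ ω * w z := fun z => by
    by_cases hz : w z = 0
    · rw [hz]; simp
    · rw [abs_mul, abs_of_nonneg (hwnn z), mul_comm]
      exact mul_le_mul_of_nonneg_right (hZtb z hz).1 (hwnn z)
  have hwZx_pt : ∀ z, |w z * (Zx z - X₀)| ≤ ω * w z := fun z => by
    by_cases hz : w z = 0
    · rw [hz]; simp
    · rw [abs_mul, abs_of_nonneg (hwnn z), mul_comm]
      exact mul_le_mul_of_nonneg_right (hZtb z hz).2 (hwnn z)
  have hwZtC : ∀ z, |w z * Zt z| ≤ Cχ * (|T₀| + 1) := fun z => by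
    by_cases hz : w z = 0
    · rw [hz]; simp; positivity
    · rw [abs_mul]
      have h1 : |Zt z| ≤ |T₀| + 1 := by
        have := (hZtb z hz).1
        have h2 := abs_sub_abs_le_abs_sub (Zt z) T₀
        linarith
      exact mul_le_mul (hwC z) h1 (abs_nonneg _) hCχ0
  have hwZxC : ∀ z, |w z * Zx z| ≤ Cχ * (|X₀| + 1) := fun z => by
    by_cases hz : w z = 0
    · rw [hz]; simp; positivity
    · rw [abs_mul]
      have h1 : |Zx z| ≤ |X₀| + 1 := by
        have := (hZtb z hz).2
        have h2 := abs_sub_abs_le_abs_sub (Zx z) X₀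
        linarith
      exact mul_le_mul (hwC z) h1 (abs_nonneg _) hCχ0
  have hZtc : ∀ z ∈ ball z₀ r, ContinuousAt Zt z := fun z hz => by
    simp only [hZt]
    exact ((hζfc z (hrr hz)).clm_apply continuousAt_const).sub
      (((hqds.continuous_fderiv (by simp)).continuousAt).clm_apply continuousAt_const)
  have hZxc : ∀ z ∈ ball z₀ r, ContinuousAt Zx z := fun z hz => by
    simp only [hZx]
    exact ((hζfc z (hrr hz)).clm_apply continuousAt_const).sub
      (((hqds.continuous_fderiv (by simp)).continuousAt).clm_apply continuousAt_const)
  have hwZtm : Measurable fun z => w z * Zt z :=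
    (continuous_of_ball (F := fun z => w z * Zt z) (ρ₁ := r / 2) (ρ₂ := r) (by linarith)
      (fun z hz => hwc.continuousAt.mul (hZtc z hz))
      (fun z hz => by show w z * Zt z = 0; rw [hw0' z hz, zero_mul])).measurable
  have hwZxm : Measurable fun z => w z * Zx z :=
    (continuous_of_ball (F := fun z => w z * Zx z) (ρ₁ := r / 2) (ρ₂ := r) (by linarith)
      (fun z hz => hwc.continuousAt.mul (hZxc z hz))
      (fun z hz => by show w z * Zx z = 0; rw [hw0' z hz, zero_mul])).measurable
  have hwZtK : ∀ z ∉ closedBall z₀ (r / 2), w z * Zt z = 0 := fun z hz => by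
    rw [hwK z hz, zero_mul]
  have hwZxK : ∀ z ∉ closedBall z₀ (r / 2), w z * Zx z = 0 := fun z hz => by
    rw [hwK z hz, zero_mul]
  -- integrability of all the pieces
  have iW : ∀ {G : ℝ → ℝ}, Continuous G → Integrable (fun z => w z * G (u z)) volume :=
    fun hG => integrable_weight_mul hwm hwC hKc hwK hu huM hG
  have iWt : ∀ {G : ℝ → ℝ}, Continuous G → Integrable (fun z => (w z * Zt z) * G (u z)) volume :=
    fun hG => integrable_weight_mul hwZtm hwZtC hKc hwZtK hu huM hG
  have iWx : ∀ {G : ℝ → ℝ}, Continuous G → Integrable (fun z => (w z * Zx z) * G (u z)) volume :=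
    fun hG => integrable_weight_mul hwZxm hwZxC hKc hwZxK hu huM hG
  have iw : Integrable w volume := by simpa using iW (G := fun _ => 1) continuous_const
  have iwu : Integrable (fun z => w z * u z) volume := iW (G := fun x => x) continuous_id
  have iwf : Integrable (fun z => w z * f (u z)) volume := iW hf.continuous
  have iwη : Integrable (fun z => w z * η (u z)) volume := iW hη.continuous
  have iwq : Integrable (fun z => w z * q (u z)) volume := iW hqc
  have iwuq : Integrable (fun z => w z * (u z * q (u z))) volume :=
    iW (G := fun x => x * q x) (continuous_id.mul hqc)
  have iwηf : Integrable (fun z => w z * (η (u z) * f (u z))) volume :=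
    iW (G := fun x => η x * f x) (hη.continuous.mul hf.continuous)
  have iwZt : Integrable (fun z => w z * Zt z) volume := by
    simpa using iWt (G := fun _ => 1) continuous_const
  have iwZx : Integrable (fun z => w z * Zx z) volume := by
    simpa using iWx (G := fun _ => 1) continuous_const
  have iwZtη : Integrable (fun z => (w z * Zt z) * η (u z)) volume := iWt hη.continuous
  have iwZxq : Integrable (fun z => (w z * Zx z) * q (u z)) volume := iWx hqc
  -- the integrals
  obtain ⟨m, hm⟩ : ∃ m : ℝ, m = ∫ z, w z := ⟨_, rfl⟩
  obtain ⟨Au, hAu⟩ : ∃ Au : ℝ, Au = ∫ z, w z * u z := ⟨_, rfl⟩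
  obtain ⟨Af, hAf⟩ : ∃ Af : ℝ, Af = ∫ z, w z * f (u z) := ⟨_, rfl⟩
  obtain ⟨Aη, hAη⟩ : ∃ Aη : ℝ, Aη = ∫ z, w z * η (u z) := ⟨_, rfl⟩
  obtain ⟨Aq, hAq⟩ : ∃ Aq : ℝ, Aq = ∫ z, w z * q (u z) := ⟨_, rfl⟩
  obtain ⟨Auq, hAuq⟩ : ∃ Auq : ℝ, Auq = ∫ z, w z * (u z * q (u z)) := ⟨_, rfl⟩
  obtain ⟨Aηf, hAηf⟩ : ∃ Aηf : ℝ, Aηf = ∫ z, w z * (η (u z) * f (u z)) := ⟨_, rfl⟩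
  obtain ⟨ZT, hZT⟩ : ∃ ZT : ℝ, ZT = ∫ z, w z * Zt z := ⟨_, rfl⟩
  obtain ⟨ZX, hZX⟩ : ∃ ZX : ℝ, ZX = ∫ z, w z * Zx z := ⟨_, rfl⟩
  obtain ⟨EηZt, hEηZt⟩ : ∃ EηZt : ℝ, EηZt = ∫ z, (w z * Zt z) * η (u z) := ⟨_, rfl⟩
  obtain ⟨EqZx, hEqZx⟩ : ∃ EqZx : ℝ, EqZx = ∫ z, (w z * Zx z) * q (u z) := ⟨_, rfl⟩
  -- (I1a): `Af + ZT = 0`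
  have I1a : Af + ZT = 0 := by
    have h0 := integral_lineDeriv_eq_zero hψLip hψcs (1, 0)
    have h1 : ∫ z, lineDeriv ℝ ψ z (1, 0) = ∫ z, (w z * f (u z) + w z * Zt z) := by
      apply integral_congr_ae
      filter_upwards [hD] with z hz
      rw [hz.1]; ring
    rw [h1, integral_add iwf iwZt] at h0
    simpa only [hAf, hZT] using h0
  -- (I1b): `Au = ZX`
  have I1b : Au = ZX := by
    have h0 := integral_lineDeriv_eq_zero hψLip hψcs (0, 1)
    have h1 : ∫ z, lineDeriv ℝ ψ z (0, 1) = ∫ z, (w z * Zx z - w z * u z) := by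
      apply integral_congr_ae
      filter_upwards [hD] with z hz
      rw [hz.2]; ring
    rw [h1, integral_sub iwZx iwu] at h0
    simp only [hAu, hZX]; linarith
  -- (I2): the single entropy inequality tested with `ψ`
  have I2 : 0 ≤ Aηf + EηZt - Auq + EqZx := by
    have hA : ∀ z, |η (u z)| ≤ max Cη Cq := fun z => (hCη _ (huM z)).trans (le_max_left _ _)
    have hB : ∀ z, |q (u z)| ≤ max Cη Cq := fun z => (hCq _ (huM z)).trans (le_max_right _ _)
    have h0 := pairing_nonneg_of_lipschitz hΩ (G₁ := fun z => η (u z)) (G₂ := fun z => q (u z))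
      (hη.continuous.measurable.comp hu) (hqc.measurable.comp hu) hA hB hE hψLip hψcs hψΩ hψnn
    have h1 : ∫ z, (η (u z) * lineDeriv ℝ ψ z (1, 0) + q (u z) * lineDeriv ℝ ψ z (0, 1))
        = ∫ z, (w z * (η (u z) * f (u z)) + (w z * Zt z) * η (u z)
            - w z * (u z * q (u z)) + (w z * Zx z) * q (u z)) := by
      apply integral_congr_ae
      filter_upwards [hD] with z hz
      rw [hz.1, hz.2]; ring
    rw [h1, integral_add, integral_sub, integral_add] at h0
    · simpa only [hAηf, hEηZt, hAuq, hEqZx] using h0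
    all_goals fun_prop
  ----------------------------------------------------------------
  -- Step 5: estimates
  ----------------------------------------------------------------
  -- generic weighted bound
  have wbound : ∀ {F : ℝ × ℝ → ℝ} {C : ℝ}, (∀ z, |F z| ≤ C * w z) → |∫ z, F z| ≤ C * m := by
    intro F C hF
    have := norm_integral_le_of_norm_le (f := F) (iw.const_mul C)
      (ae_of_all _ fun z => by rw [Real.norm_eq_abs]; exact hF z)
    rw [Real.norm_eq_abs, integral_const_mul, ← hm] at this
    exact this
  have hm0 : 0 ≤ m := by rw [hm]; exact integral_nonneg hwnn
  -- positivity of the mass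
  have hm_pos : 0 < m := by
    have hK0 : (0 : ℝ) ≤ Kg := Kg.2
    have hK1 : (0 : ℝ) < (Kg : ℝ) + 1 := by linarith
    obtain ⟨ρ₀, hρ₀⟩ : ∃ ρ₀ : ℝ, ρ₀ = min (r / 2) (δ / (2 * ((Kg : ℝ) + 1))) := ⟨_, rfl⟩
    have hρ₀pos : 0 < ρ₀ := by
      rw [hρ₀]; exact lt_min (by linarith) (div_pos hδ (by linarith))
    have hρ₀r : ρ₀ ≤ r / 2 := by rw [hρ₀]; exact min_le_left _ _
    have hρ₀d : ρ₀ ≤ δ / (2 * ((Kg : ℝ) + 1)) := by rw [hρ₀]; exact min_le_right _ _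
    have hone : ∀ z ∈ ball z₀ ρ₀, w z = 1 := by
      intro z hz
      have hzr : z ∈ ball z₀ r := ball_subset_ball (by linarith) hz
      have hz0r : z₀ ∈ ball z₀ r := mem_ball_self hr
      have hgz : g z < δ / 2 := by
        have h1 := hgL.dist_le_mul z hzr z₀ hz0r
        rw [hg0, Real.dist_eq, sub_zero, abs_of_nonneg (hgnn z)] at h1
        have h2 : dist z z₀ < δ / (2 * ((Kg : ℝ) + 1)) := (mem_ball.mp hz).trans_le hρ₀d
        have h3 : (Kg : ℝ) * dist z z₀ ≤ ((Kg : ℝ) + 1) * dist z z₀ :=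
          mul_le_mul_of_nonneg_right (by linarith) dist_nonneg
        have h4 : ((Kg : ℝ) + 1) * dist z z₀ < ((Kg : ℝ) + 1) * (δ / (2 * ((Kg : ℝ) + 1))) :=
          mul_lt_mul_of_pos_left h2 hK1
        have h5 : ((Kg : ℝ) + 1) * (δ / (2 * ((Kg : ℝ) + 1))) = δ / 2 := by
          field_simp
        linarith
      rw [hw_ball z hzr, hχ'1 _ hgz, neg_neg]
    have hind : ∀ z, (ball z₀ ρ₀).indicator (fun _ => (1 : ℝ)) z ≤ w z := by
      intro z
      by_cases hz : z ∈ ball z₀ ρ₀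
      · rw [indicator_of_mem hz, hone z hz]
      · rw [indicator_of_notMem hz]; exact hwnn z
    have hint : ∫ z, (ball z₀ ρ₀).indicator (fun _ => (1 : ℝ)) z = (volume (ball z₀ ρ₀)).toReal := by
      rw [integral_indicator_const _ measurableSet_ball, smul_eq_mul, mul_one]
      rfl
    have hvol : 0 < (volume (ball z₀ ρ₀)).toReal :=
      ENNReal.toReal_pos (measure_ball_pos volume z₀ hρ₀pos).ne' measure_ball_lt_top.ne
    have hle : ∫ z, (ball z₀ ρ₀).indicator (fun _ => (1 : ℝ)) z ≤ ∫ z, w z :=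
      integral_mono ((integrable_indicator_iff measurableSet_ball).mpr
        (integrableOn_const measure_ball_lt_top.ne)) iw hind
    rw [hm]; linarith
  -- elementary bounds on the averages
  have bAη : |Aη| ≤ Cη * m := by
    rw [hAη]
    exact wbound fun z => by
      rw [abs_mul, abs_of_nonneg (hwnn z), mul_comm]
      exact mul_le_mul_of_nonneg_right (hCη _ (huM z)) (hwnn z)
  have bAq : |Aq| ≤ Cq * m := by
    rw [hAq]
    exact wbound fun z => by
      rw [abs_mul, abs_of_nonneg (hwnn z), mul_comm]
      exact mul_le_mul_of_nonneg_right (hCq _ (huM z)) (hwnn z)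
  have bAu : |Au| ≤ M * m := by
    rw [hAu]
    exact wbound fun z => by
      rw [abs_mul, abs_of_nonneg (hwnn z), mul_comm]
      exact mul_le_mul_of_nonneg_right (huM z) (hwnn z)
  have bZT : |ZT - T₀ * m| ≤ ω * m := by
    have e : ZT - T₀ * m = ∫ z, w z * (Zt z - T₀) := by
      simp only [hZT, hm]
      rw [← integral_const_mul, ← integral_sub iwZt (iw.const_mul T₀)]
      congr 1; funext z; ring
    rw [e]; exact wbound hwZt_pt
  have bZX : |ZX - X₀ * m| ≤ ω * m := by
    have e : ZX - X₀ * m = ∫ z, w z * (Zx z - X₀) := by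
      simp only [hZX, hm]
      rw [← integral_const_mul, ← integral_sub iwZx (iw.const_mul X₀)]
      congr 1; funext z; ring
    rw [e]; exact wbound hwZx_pt
  have bEη : |EηZt - T₀ * Aη| ≤ Cη * ω * m := by
    have e : EηZt - T₀ * Aη = ∫ z, (w z * (Zt z - T₀)) * η (u z) := by
      simp only [hEηZt, hAη]
      rw [← integral_const_mul, ← integral_sub iwZtη (iwη.const_mul T₀)]
      congr 1; funext z; ring
    rw [e]
    exact wbound fun z => by
      rw [abs_mul]
      have h1 := hwZt_pt z
      have h2 := hCη _ (huM z)
      calc |w z * (Zt z - T₀)| * |η (u z)| ≤ (ω * w z) * Cη :=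
            mul_le_mul h1 h2 (abs_nonneg _) (mul_nonneg hω0.le (hwnn z))
        _ = Cη * ω * w z := by ring
  have bEq : |EqZx - X₀ * Aq| ≤ Cq * ω * m := by
    have e : EqZx - X₀ * Aq = ∫ z, (w z * (Zx z - X₀)) * q (u z) := by
      simp only [hEqZx, hAq]
      rw [← integral_const_mul, ← integral_sub iwZxq (iwq.const_mul X₀)]
      congr 1; funext z; ring
    rw [e]
    exact wbound fun z => by
      rw [abs_mul]
      have h1 := hwZx_pt z
      have h2 := hCq _ (huM z)
      calc |w z * (Zx z - X₀)| * |q (u z)| ≤ (ω * w z) * Cq :=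
            mul_le_mul h1 h2 (abs_nonneg _) (mul_nonneg hω0.le (hwnn z))
        _ = Cq * ω * w z := by ring
  -- the bilinear form is small
  have bB : m * Auq - m * Aηf + Af * Aη - Au * Aq ≤ 2 * (Cη + Cq) * ω * m ^ 2 := by
    have e1 : Af = -ZT := by linarith
    have step1 : m * Auq - m * Aηf + Af * Aη - Au * Aq
        ≤ (m * (EηZt - T₀ * Aη) - (ZT - T₀ * m) * Aη)
          + (m * (EqZx - X₀ * Aq) - (ZX - X₀ * m) * Aq) := by
      rw [e1, I1b]
      have hx : Auq - Aηf ≤ EηZt + EqZx := by linarith only [I2]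
      nlinarith only [mul_le_mul_of_nonneg_left hx hm0]
    have t1 : m * (EηZt - T₀ * Aη) ≤ m * (Cη * ω * m) :=
      mul_le_mul_of_nonneg_left ((le_abs_self _).trans bEη) hm0
    have t2 : -((ZT - T₀ * m) * Aη) ≤ (ω * m) * (Cη * m) := by
      rw [← neg_mul]
      calc -(ZT - T₀ * m) * Aη ≤ |-(ZT - T₀ * m) * Aη| := le_abs_self _
        _ = |ZT - T₀ * m| * |Aη| := by rw [abs_mul, abs_neg]
        _ ≤ (ω * m) * (Cη * m) := mul_le_mul bZT bAη (abs_nonneg _) (by positivity)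
    have t3 : m * (EqZx - X₀ * Aq) ≤ m * (Cq * ω * m) :=
      mul_le_mul_of_nonneg_left ((le_abs_self _).trans bEq) hm0
    have t4 : -((ZX - X₀ * m) * Aq) ≤ (ω * m) * (Cq * m) := by
      rw [← neg_mul]
      calc -(ZX - X₀ * m) * Aq ≤ |-(ZX - X₀ * m) * Aq| := le_abs_self _
        _ = |ZX - X₀ * m| * |Aq| := by rw [abs_mul, abs_neg]
        _ ≤ (ω * m) * (Cq * m) := mul_le_mul bZX bAq (abs_nonneg _) (by positivity)
    nlinarith only [step1, t1, t2, t3, t4]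
  -- Prop. 3.2 (weighted) and the fourth moment
  have prop := dlow_prop32_weighted hwm hwnn hwC hKc hwK hu huM hf hη ha.le hb.le hfa hηb hq
  obtain ⟨M4, hM4⟩ : ∃ M4 : ℝ, M4 = ∫ z, ∫ z', w z * w z' * (u z - u z') ^ 4 := ⟨_, rfl⟩
  have hab : 0 < a * b := mul_pos ha hb
  have bM4 : M4 ≤ 24 / (a * b) * (2 * (Cη + Cq) * ω * m ^ 2) := by
    rw [← hm, ← hAuq, ← hAηf, ← hAf, ← hAη, ← hAu, ← hAq, ← hM4] at prop
    have h1 : a * b / 24 * M4 ≤ 2 * (Cη + Cq) * ω * m ^ 2 := prop.trans bB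
    rw [div_mul_eq_mul_div, le_div_iff₀ hab]
    have e : a * b / 24 * M4 * 24 = M4 * (a * b) := by ring
    nlinarith only [h1, e]
  -- fourth moment about the mean
  obtain ⟨ū, hū⟩ : ∃ ū : ℝ, ū = Au / m := ⟨_, rfl⟩
  have hūM : |ū| ≤ M := by
    rw [hū, abs_div, abs_of_pos hm_pos, div_le_iff₀ hm_pos]; exact bAu
  have h4i : Integrable (fun p : (ℝ × ℝ) × (ℝ × ℝ) => w p.1 * w p.2 * (u p.1 - u p.2) ^ 4)
      (volume.prod volume) :=
    integrable_weight_prod hwm hwC hKc hwK hu huM (G := fun c => (c.1 - c.2) ^ 4) (by fun_prop)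
  have J4 : m * ∫ z, w z * (u z - ū) ^ 4 ≤ M4 := by
    have inner : ∀ z, w z * (m * (u z - ū) ^ 4) ≤ ∫ z', w z * w z' * (u z - u z') ^ 4 := by
      intro z
      have hc : (u z - ū) * m = u z * m - Au := by
        simp only [hū]; field_simp
      have i1 : Integrable (fun z' => w z' * (u z - u z') ^ 4) volume :=
        iW (G := fun y => (u z - y) ^ 4) (by fun_prop)
      have i2 : Integrable (fun z' => w z' * ((u z - ū) ^ 4
          + 4 * (u z - ū) ^ 3 * ((u z - u z') - (u z - ū)))) volume := by
        have : (fun z' => w z' * ((u z - ū) ^ 4 + 4 * (u z - ū) ^ 3 * ((u z - u z') - (u z - ū))))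
            = fun z' => ((u z - ū) ^ 4 + 4 * (u z - ū) ^ 3 * (ū)) * w z'
              + (-(4 * (u z - ū) ^ 3)) * (w z' * u z') := by
          funext z'; ring
        rw [this]
        exact (iw.const_mul _).add (iwu.const_mul _)
      have hmono : ∫ z', w z' * ((u z - ū) ^ 4 + 4 * (u z - ū) ^ 3 * ((u z - u z') - (u z - ū)))
          ≤ ∫ z', w z' * (u z - u z') ^ 4 := by
        apply integral_mono i2 i1
        intro z'
        apply mul_le_mul_of_nonneg_left _ (hwnn z')
        nlinarith [mul_nonneg (sq_nonneg ((u z - u z') - (u z - ū)))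
          (sq_nonneg ((u z - u z') + (u z - ū))),
          mul_nonneg (sq_nonneg (u z - ū)) (sq_nonneg ((u z - u z') - (u z - ū)))]
      have hval : ∫ z', w z' * ((u z - ū) ^ 4 + 4 * (u z - ū) ^ 3 * ((u z - u z') - (u z - ū)))
          = m * (u z - ū) ^ 4 := by
        have : (fun z' => w z' * ((u z - ū) ^ 4 + 4 * (u z - ū) ^ 3 * ((u z - u z') - (u z - ū))))
            = fun z' => ((u z - ū) ^ 4 + 4 * (u z - ū) ^ 3 * (ū)) * w z'
              + (-(4 * (u z - ū) ^ 3)) * (w z' * u z') := by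
          funext z'; ring
        rw [this, integral_add (iw.const_mul _) (iwu.const_mul _), integral_const_mul,
          integral_const_mul, ← hm, ← hAu]
        have : ū * m = Au := by rw [hū]; field_simp
        linear_combination (4 * (u z - ū) ^ 3) * this
      have e3 : ∫ z', w z * w z' * (u z - u z') ^ 4 = w z * ∫ z', w z' * (u z - u z') ^ 4 := by
        rw [← integral_const_mul]; congr 1; funext z'; ring
      rw [e3]
      calc w z * (m * (u z - ū) ^ 4) = w z * ∫ z', w z' * ((u z - ū) ^ 4
            + 4 * (u z - ū) ^ 3 * ((u z - u z') - (u z - ū))) := by rw [hval]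
        _ ≤ w z * ∫ z', w z' * (u z - u z') ^ 4 := mul_le_mul_of_nonneg_left hmono (hwnn z)
    have lhs_i : Integrable (fun z => w z * (m * (u z - ū) ^ 4)) volume := by
      have := (iW (G := fun y => (y - ū) ^ 4) (by fun_prop)).const_mul m
      refine this.congr (ae_of_all _ fun z => ?_)
      simp only; ring
    have := integral_mono lhs_i h4i.integral_prod_left inner
    rw [show (∫ z, w z * (m * (u z - ū) ^ 4)) = m * ∫ z, w z * (u z - ū) ^ 4 by
      rw [← integral_const_mul]; congr 1; funext z; ring] at this
    simpa only [hM4] using this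
  -- from the fourth moment to the first absolute moment (AM–GM)
  have amgm : ∀ y : ℝ, |y| ≤ lam + y ^ 4 / lam ^ 3 := by
    intro y
    by_cases hy : |y| ≤ lam
    · have : 0 ≤ y ^ 4 / lam ^ 3 := by positivity
      linarith
    · push Not at hy
      have h1 : lam ^ 3 ≤ |y| ^ 3 := by gcongr
      have h2 : lam ^ 3 * |y| ≤ y ^ 4 := by
        have : |y| ^ 4 = y ^ 4 := by rw [pow_abs, abs_of_nonneg (by positivity)]
        nlinarith [abs_nonneg y]
      have h3 : |y| ≤ y ^ 4 / lam ^ 3 := by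
        rw [le_div_iff₀ (by positivity)]; linarith
      linarith
  have bA1 : ∫ z, w z * |u z - ū| ≤ lam * m + (∫ z, w z * (u z - ū) ^ 4) / lam ^ 3 := by
    have i1 : Integrable (fun z => w z * |u z - ū|) volume :=
      iW (G := fun y => |y - ū|) (by fun_prop)
    have i4 : Integrable (fun z => w z * (u z - ū) ^ 4) volume :=
      iW (G := fun y => (y - ū) ^ 4) (by fun_prop)
    have i2 : Integrable (fun z => lam * w z + (1 / lam ^ 3) * (w z * (u z - ū) ^ 4)) volume :=
      (iw.const_mul _).add (i4.const_mul _)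
    have hle := integral_mono i1 i2 fun z => by
      have := mul_le_mul_of_nonneg_left (amgm (u z - ū)) (hwnn z)
      have e : w z * (lam + (u z - ū) ^ 4 / lam ^ 3)
          = lam * w z + 1 / lam ^ 3 * (w z * (u z - ū) ^ 4) := by
        field_simp
      simpa only [e] using this
    rw [integral_add (iw.const_mul _) (i4.const_mul _), integral_const_mul, integral_const_mul] at hle
    simp only [← hm] at hle
    have e2 : 1 / lam ^ 3 * ∫ z, w z * (u z - ū) ^ 4 = (∫ z, w z * (u z - ū) ^ 4) / lam ^ 3 := by
      field_simp
    linarith [e2]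
  -- Lipschitz bound for `f` on the averages
  have bAf : |Af - m * f ū| ≤ Lf * ∫ z, w z * |u z - ū| := by
    have e : Af - m * f ū = ∫ z, w z * (f (u z) - f ū) := by
      rw [hAf, hm, ← integral_mul_const, ← integral_sub iwf (iw.mul_const _)]
      congr 1; funext z; ring
    rw [e]
    have i1 : Integrable (fun z => Lf * (w z * |u z - ū|)) volume :=
      (iW (G := fun y => |y - ū|) (by fun_prop)).const_mul Lf
    have := norm_integral_le_of_norm_le (f := fun z => w z * (f (u z) - f ū)) i1
      (ae_of_all _ fun z => by
        rw [Real.norm_eq_abs, abs_mul, abs_of_nonneg (hwnn z)]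
        have := hLf (u z) ū ((huM z).trans (by linarith)) (hūM.trans (by linarith))
        nlinarith [hwnn z])
    rw [Real.norm_eq_abs, integral_const_mul] at this
    exact this
  ----------------------------------------------------------------
  -- Step 6: conclusion
  ----------------------------------------------------------------
  have hM4' : ∫ z, w z * (u z - ū) ^ 4 ≤ 48 * (Cη + Cq) * ω * m / (a * b) := by
    rw [le_div_iff₀ hab]
    have h1 : m * ∫ z, w z * (u z - ū) ^ 4 ≤ 24 / (a * b) * (2 * (Cη + Cq) * ω * m ^ 2) :=
      J4.trans bM4
    have h2 : (m * ∫ z, w z * (u z - ū) ^ 4) * (a * b) ≤ 48 * (Cη + Cq) * ω * m ^ 2 := by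
      have := mul_le_mul_of_nonneg_right h1 hab.le
      rw [show 24 / (a * b) * (2 * (Cη + Cq) * ω * m ^ 2) * (a * b)
        = 48 * (Cη + Cq) * ω * m ^ 2 by field_simp; ring] at this
      exact this
    have h3 : (∫ z, w z * (u z - ū) ^ 4) * (a * b) * m ≤ 48 * (Cη + Cq) * ω * m * m := by
      have e1 : (∫ z, w z * (u z - ū) ^ 4) * (a * b) * m
          = (m * ∫ z, w z * (u z - ū) ^ 4) * (a * b) := by ring
      have e2 : 48 * (Cη + Cq) * ω * m * m = 48 * (Cη + Cq) * ω * m ^ 2 := by ring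
      rw [e1, e2]; exact h2
    exact le_of_mul_le_mul_right h3 hm_pos
  -- the two small errors
  obtain ⟨e₂, he₂⟩ : ∃ e₂ : ℝ, e₂ = (X₀ * m - ZX) / m := ⟨_, rfl⟩
  have he₂b : |e₂| ≤ ω := by
    rw [he₂, abs_div, abs_of_pos hm_pos, div_le_iff₀ hm_pos, abs_sub_comm]; exact bZX
  have hX₀e : X₀ = ū + e₂ := by
    simp only [hū, he₂, ← I1b]; field_simp; ring
  have bfX : |f X₀ - f ū| ≤ Lf * ω := by
    have h1 := hLf X₀ ū (by
      rw [hX₀e]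
      calc |ū + e₂| ≤ |ū| + |e₂| := abs_add_le _ _
        _ ≤ M + 1 := by linarith) (hūM.trans (by linarith))
    rw [hX₀e, add_sub_cancel_left] at h1
    rw [hX₀e]
    calc |f (ū + e₂) - f ū| ≤ Lf * |e₂| := h1
      _ ≤ Lf * ω := mul_le_mul_of_nonneg_left he₂b hLf0
  -- assemble: `m (T₀ + f X₀) = -(Af - m f ū) - (ZT - T₀ m) + m (f X₀ - f ū)`
  have key : m * (T₀ + f X₀)
      ≥ -(ω * m + Lf * ω * m + Lf * lam * m + 48 * Lf * (Cη + Cq) * ω * m / (a * b * lam ^ 3)) := by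
    have e : m * (T₀ + f X₀) = -(Af - m * f ū) - (ZT - T₀ * m) + m * (f X₀ - f ū) := by
      linarith [I1a]
    rw [e]
    have t1 : -(Af - m * f ū) ≥ -(Lf * (lam * m + (48 * (Cη + Cq) * ω * m / (a * b)) / lam ^ 3)) := by
      have h1 := (le_abs_self _).trans bAf
      have h2 : Lf * ∫ z, w z * |u z - ū| ≤ Lf * (lam * m + (48 * (Cη + Cq) * ω * m / (a * b)) / lam ^ 3) := by
        apply mul_le_mul_of_nonneg_left _ hLf0
        refine bA1.trans ?_
        gcongr
      linarith
    have t2 : -(ZT - T₀ * m) ≥ -(ω * m) := by linarith only [(le_abs_self _).trans bZT]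
    have t3 : m * (f X₀ - f ū) ≥ -(m * (Lf * ω)) := by
      have h := (abs_le.mp bfX).1
      nlinarith only [mul_le_mul_of_nonneg_left h hm0]
    have e4 : Lf * (lam * m + (48 * (Cη + Cq) * ω * m / (a * b)) / lam ^ 3)
        = Lf * lam * m + 48 * Lf * (Cη + Cq) * ω * m / (a * b * lam ^ 3) := by
      field_simp
    linarith only [t1, t2, t3, e4]
  have key' : m * (-(ω + Lf * ω + Lf * lam + 48 * Lf * (Cη + Cq) * ω / (a * b * lam ^ 3)))
      ≤ m * (T₀ + f X₀) := by
    have e5 : m * (-(ω + Lf * ω + Lf * lam + 48 * Lf * (Cη + Cq) * ω / (a * b * lam ^ 3)))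
        = -(ω * m + Lf * ω * m + Lf * lam * m + 48 * Lf * (Cη + Cq) * ω * m / (a * b * lam ^ 3)) := by
      ring
    rw [e5]; exact key
  exact le_of_mul_le_mul_left key' hm_pos
set_option maxHeartbeats 400000 in -- buildfix (bf3-g26): 160k/180k FAIL, 200k PASS at accept time; line-neutral budget line
/-- **The potential is a viscosity supersolution** (De Lellis–Otto–Westdickenberg 2004, §4.2;
weighted variant of the proof): if `u ∈ L^∞` satisfies the single entropy inequality
`η(u)ₜ + q(u)ₓ ≤ 0` in `𝒟'(Ω)` for a uniformly convex pair `f, η` and `h` is bounded Lipschitz with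
a.e. gradient `(-f(u), u)` on an open `V ⊆ Ω`, then at every local minimum `z₀ ∈ V` of `h - ζ`
with `ζ` of class `C¹` near `z₀` one has `ζₜ(z₀) + f(ζₓ(z₀)) ≥ 0`.
[cite: DelellisOttoWestdickenberg2004, Thm 2.3 (§4.2)] -/
theorem viscosity_supersolution {f η q : ℝ → ℝ} {a b : ℝ} (hf : ContDiff ℝ 2 f)
    (hη : ContDiff ℝ 2 η) (ha : 0 < a) (hb : 0 < b) (hfa : ∀ w, a ≤ deriv (deriv f) w)
    (hηb : ∀ w, b ≤ deriv (deriv η) w) (hq : ∀ w, HasDerivAt q (deriv f w * deriv η w) w)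
    {Ω : Set (ℝ × ℝ)} (hΩ : IsOpen Ω) {u : ℝ × ℝ → ℝ} (hu : Measurable u) {M : ℝ}
    (huM : ∀ p, |u p| ≤ M)
    (hE : ∀ φ : ℝ × ℝ → ℝ, ContDiff ℝ (⊤ : ℕ∞) φ → HasCompactSupport φ → tsupport φ ⊆ Ω →
      (∀ p, 0 ≤ φ p) →
      0 ≤ ∫ p in Ω, (η (u p) * deriv (fun t => φ (t, p.2)) p.1
        + q (u p) * deriv (fun x => φ (p.1, x)) p.2))
    {h : ℝ × ℝ → ℝ} {L : ℝ≥0} (hh : LipschitzWith L h)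
    {V : Set (ℝ × ℝ)} (hV : IsOpen V) (hVΩ : V ⊆ Ω)
    (hae : ∀ᵐ z ∂(volume : Measure (ℝ × ℝ)), z ∈ V →
      DifferentiableAt ℝ h z ∧ fderiv ℝ h z (1, 0) = -f (u z) ∧ fderiv ℝ h z (0, 1) = u z)
    {z₀ : ℝ × ℝ} (hz₀ : z₀ ∈ V) {ζ : ℝ × ℝ → ℝ} (hζ : ContDiffAt ℝ 1 ζ z₀)
    (hmin : IsLocalMin (fun z => h z - ζ z) z₀) :
    0 ≤ fderiv ℝ ζ z₀ (1, 0) + f (fderiv ℝ ζ z₀ (0, 1)) := by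
  -- constants
  have hqc : Continuous q := continuous_iff_continuousAt.2 fun w => (hq w).continuousAt
  obtain ⟨Cη, hCη0, hCη⟩ := exists_abs_le_on_Icc hη.continuous M
  obtain ⟨Cq, hCq0, hCq⟩ := exists_abs_le_on_Icc hqc M
  obtain ⟨Lf, hLf0, hLf'⟩ := exists_abs_le_on_Icc (hf.continuous_deriv (by norm_num)) (M + 1)
  have hLf : ∀ x y, |x| ≤ M + 1 → |y| ≤ M + 1 → |f x - f y| ≤ Lf * |x - y| := by
    intro x y hx hy
    have := Convex.norm_image_sub_le_of_norm_deriv_le (f := f) (s := Icc (-(M + 1)) (M + 1))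
      (fun z _ => (hf.differentiable (by norm_num)) z)
      (fun z hz => by rw [Real.norm_eq_abs]; exact hLf' z (abs_le.mpr ⟨hz.1, hz.2⟩))
      (convex_Icc _ _) (mem_Icc.mpr (abs_le.mp hy)) (mem_Icc.mpr (abs_le.mp hx))
    rwa [Real.norm_eq_abs, Real.norm_eq_abs] at this
  -- a radius
  obtain ⟨r₁, hr₁, hζr⟩ : ∃ r₁ > 0, ∀ y ∈ ball z₀ r₁, ContDiffAt ℝ 1 ζ y :=
    Metric.eventually_nhds_iff_ball.mp (hζ.eventually (by simp))
  obtain ⟨r₂, hr₂, hminr⟩ : ∃ r₂ > 0, ∀ y ∈ ball z₀ r₂, h z₀ - ζ z₀ ≤ h y - ζ y :=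
    Metric.eventually_nhds_iff_ball.mp hmin
  obtain ⟨r₃, hr₃, hVr⟩ : ∃ r₃ > 0, ball z₀ r₃ ⊆ V := Metric.isOpen_iff.mp hV z₀ hz₀
  obtain ⟨r, hr, hr1, hr2, hr3⟩ : ∃ r : ℝ, 0 < r ∧ 2 * r ≤ r₁ ∧ 2 * r ≤ r₂ ∧ 2 * r ≤ r₃ :=
    ⟨min (min r₁ r₂) r₃ / 2, by positivity,
      by nlinarith [min_le_left (min r₁ r₂) r₃, min_le_left r₁ r₂],
      by nlinarith [min_le_left (min r₁ r₂) r₃, min_le_right r₁ r₂],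
      by nlinarith [min_le_right (min r₁ r₂) r₃]⟩
  have hrV : ball z₀ (2 * r) ⊆ V := (ball_subset_ball hr3).trans hVr
  have hζ2 : ∀ y ∈ ball z₀ (2 * r), ContDiffAt ℝ 1 ζ y := fun y hy =>
    hζr y (ball_subset_ball hr1 hy)
  have hmin2 : ∀ y ∈ ball z₀ (2 * r), h z₀ - ζ z₀ ≤ h y - ζ y := fun y hy =>
    hminr y (ball_subset_ball hr2 hy)
  -- the perturbation's derivative is continuous and vanishes at `z₀`
  have hqds : ContDiff ℝ (⊤ : ℕ∞) (fun z : ℝ × ℝ => (z.1 - z₀.1) ^ 2 + (z.2 - z₀.2) ^ 2) := by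
    fun_prop
  have hqd1 := hqds.differentiable (by simp)
  have hqd0 : fderiv ℝ (fun z : ℝ × ℝ => (z.1 - z₀.1) ^ 2 + (z.2 - z₀.2) ^ 2) z₀ = 0 := by
    have hmin' : IsLocalMin (fun z : ℝ × ℝ => (z.1 - z₀.1) ^ 2 + (z.2 - z₀.2) ^ 2) z₀ :=
      Filter.Eventually.of_forall fun z => by
        show (z₀.1 - z₀.1) ^ 2 + (z₀.2 - z₀.2) ^ 2 ≤ (z.1 - z₀.1) ^ 2 + (z.2 - z₀.2) ^ 2
        nlinarith [sq_nonneg (z.1 - z₀.1), sq_nonneg (z.2 - z₀.2)]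
    exact hmin'.hasFDerivAt_eq_zero (hqd1 z₀).hasFDerivAt
  have hqdc : ContinuousAt (fderiv ℝ (fun z : ℝ × ℝ => (z.1 - z₀.1) ^ 2 + (z.2 - z₀.2) ^ 2)) z₀ :=
    (hqds.continuous_fderiv (by simp)).continuousAt
  have hζfc : ContinuousAt (fderiv ℝ ζ) z₀ := hζ.continuousAt_fderiv (by simp)
  -- `κ`-argument
  apply le_of_forall_pos_le_add
  intro κ hκ
  set lam : ℝ := κ / (4 * (Lf + 1)) with hlam
  have hlam0 : 0 < lam := by positivity
  set Cω : ℝ := 1 + Lf + 48 * Lf * (Cη + Cq) / (a * b * lam ^ 3) with hCω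
  have hCω0 : 0 < Cω := by positivity
  set ω : ℝ := min 1 (κ / (2 * Cω)) with hωdef
  have hω0 : 0 < ω := by positivity
  have hω1 : ω ≤ 1 := min_le_left _ _
  have hωκ : ω * Cω ≤ κ / 2 := by
    have : ω ≤ κ / (2 * Cω) := min_le_right _ _
    rw [le_div_iff₀ (by positivity)] at this
    linarith
  -- continuity radius for the derivatives
  obtain ⟨ρ₁, hρ₁, hρζ⟩ := Metric.continuousAt_iff.mp hζfc (ω / 2) (by positivity)
  obtain ⟨ρ₂, hρ₂, hρq⟩ := Metric.continuousAt_iff.mp hqdc (ω / 2) (by positivity)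
  set ρ' : ℝ := min ρ₁ ρ₂ with hρ'
  have hρ'0 : 0 < ρ' := lt_min hρ₁ hρ₂
  have hosc : ∀ y ∈ ball z₀ ρ', ∀ v : ℝ × ℝ, ‖v‖ ≤ 1 →
      |fderiv ℝ ζ y v - fderiv ℝ (fun z : ℝ × ℝ => (z.1 - z₀.1) ^ 2 + (z.2 - z₀.2) ^ 2) y v
        - fderiv ℝ ζ z₀ v| ≤ ω := by
    intro y hy v hv
    have d1 : dist y z₀ < ρ₁ := (mem_ball.mp hy).trans_le (min_le_left _ _)
    have d2 : dist y z₀ < ρ₂ := (mem_ball.mp hy).trans_le (min_le_right _ _)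
    have e1 := hρζ d1
    have e2 := hρq d2
    rw [hqd0, dist_zero_right] at e2
    rw [dist_eq_norm] at e1
    have b1 : |(fderiv ℝ ζ y - fderiv ℝ ζ z₀) v| ≤ ω / 2 := by
      rw [← Real.norm_eq_abs]
      calc ‖(fderiv ℝ ζ y - fderiv ℝ ζ z₀) v‖ ≤ ‖fderiv ℝ ζ y - fderiv ℝ ζ z₀‖ * ‖v‖ :=
            ContinuousLinearMap.le_opNorm _ _
        _ ≤ ω / 2 * 1 := mul_le_mul e1.le hv (norm_nonneg _) (by positivity)
        _ = ω / 2 := mul_one _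
    have b2 : |fderiv ℝ (fun z : ℝ × ℝ => (z.1 - z₀.1) ^ 2 + (z.2 - z₀.2) ^ 2) y v| ≤ ω / 2 := by
      rw [← Real.norm_eq_abs]
      calc ‖fderiv ℝ (fun z : ℝ × ℝ => (z.1 - z₀.1) ^ 2 + (z.2 - z₀.2) ^ 2) y v‖
          ≤ ‖fderiv ℝ (fun z : ℝ × ℝ => (z.1 - z₀.1) ^ 2 + (z.2 - z₀.2) ^ 2) y‖ * ‖v‖ :=
            ContinuousLinearMap.le_opNorm _ _
        _ ≤ ω / 2 * 1 := mul_le_mul e2.le hv (norm_nonneg _) (by positivity)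
        _ = ω / 2 := mul_one _
    rw [_root_.sub_apply] at b1
    have e : fderiv ℝ ζ y v - fderiv ℝ (fun z : ℝ × ℝ => (z.1 - z₀.1) ^ 2 + (z.2 - z₀.2) ^ 2) y v
        - fderiv ℝ ζ z₀ v
        = (fderiv ℝ ζ y v - fderiv ℝ ζ z₀ v)
          - fderiv ℝ (fun z : ℝ × ℝ => (z.1 - z₀.1) ^ 2 + (z.2 - z₀.2) ^ 2) y v := by ring
    rw [e]
    exact (abs_sub _ _).trans (by linarith)
  -- the sublevel parameter `δ`
  set δ : ℝ := min (r ^ 2 / 4) (ρ' ^ 2) with hδdef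
  have hδ0 : 0 < δ := by positivity
  have hδr : δ ≤ r ^ 2 / 4 := min_le_left _ _
  have hω' : ∀ y ∈ ball z₀ r, (y.1 - z₀.1) ^ 2 + (y.2 - z₀.2) ^ 2 < δ →
      |fderiv ℝ ζ y (1, 0) - fderiv ℝ (fun z : ℝ × ℝ => (z.1 - z₀.1) ^ 2 + (z.2 - z₀.2) ^ 2) y (1, 0)
          - fderiv ℝ ζ z₀ (1, 0)| ≤ ω ∧
      |fderiv ℝ ζ y (0, 1) - fderiv ℝ (fun z : ℝ × ℝ => (z.1 - z₀.1) ^ 2 + (z.2 - z₀.2) ^ 2) y (0, 1)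
          - fderiv ℝ ζ z₀ (0, 1)| ≤ ω := by
    intro y _ hq'
    have hyρ : y ∈ ball z₀ ρ' := by
      rw [mem_ball]
      have h1 : (dist y z₀) ^ 2 ≤ (y.1 - z₀.1) ^ 2 + (y.2 - z₀.2) ^ 2 := by
        rw [Prod.dist_eq, Real.dist_eq, Real.dist_eq]
        rcases le_total |y.1 - z₀.1| |y.2 - z₀.2| with hle | hle
        · rw [max_eq_right hle]; nlinarith [sq_abs (y.2 - z₀.2), sq_nonneg (y.1 - z₀.1)]
        · rw [max_eq_left hle]; nlinarith [sq_abs (y.1 - z₀.1), sq_nonneg (y.2 - z₀.2)]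
      have h2 : (dist y z₀) ^ 2 < ρ' ^ 2 := by
        have : δ ≤ ρ' ^ 2 := min_le_right _ _
        linarith
      by_contra hge
      push Not at hge
      nlinarith [hge, dist_nonneg (x := y) (y := z₀), hρ'0]
    exact ⟨hosc y hyρ (1, 0) (by simp [Prod.norm_def]), hosc y hyρ (0, 1) (by simp [Prod.norm_def])⟩
  have core := supersolution_core hf hη ha hb hfa hηb hq hΩ hu huM hE hh hVΩ hae hr hrV hζ2 hmin2
    hCη0 hCq0 hLf0 hCη hCq hLf hδ0 hδr hω0 hω1 hω' hlam0
  -- the error is at most `κ`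
  have herr : ω + Lf * ω + Lf * lam + 48 * Lf * (Cη + Cq) * ω / (a * b * lam ^ 3) ≤ κ := by
    have e1 : ω + Lf * ω + 48 * Lf * (Cη + Cq) * ω / (a * b * lam ^ 3) = ω * Cω := by
      simp only [hCω]; ring
    have e2 : Lf * lam ≤ κ / 4 := by
      have : Lf * lam = (Lf / (Lf + 1)) * (κ / 4) := by
        simp only [hlam]; field_simp
      rw [this]
      exact mul_le_of_le_one_left (by positivity) ((div_le_one (by positivity)).mpr (by linarith))
    linarith
  linarith

end Supersolution

end Literature.Analysis.PDE.SingleEntropy
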